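import Summits.NavierStokesRegularity.NavierStokesRegularity.Theorems.ExtremiserTransienceMemberSelectionDefs
import Summits.NavierStokesRegularity.NavierStokesRegularity.Theorems.ExtremiserTransienceNearExtremalTransiencePerFlowMemberSelectionZoomCompact
import Summits.NavierStokesRegularity.NavierStokesRegularity.Theorems.ExtremiserTransienceNearExtremalTransiencePerFlowMemberSelectionZoomRegularity
import Summits.NavierStokesRegularity.NavierStokesRegularity.Theorems.ExtremiserTransienceNearExtremalTransiencePerFlowMemberSelectionZoomInvariance
import Summits.NavierStokesRegularity.NavierStokesRegularity.Theorems.TypeICertificateLadderRungReynoldsOneTaoCover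
import Summits.NavierStokesRegularity.NavierStokesRegularity.Theorems.ExtremiserTransienceNearExtremalTransienceThetaOne
import HarnessLib

/-!
# Route `ExtremiserTransience`, crux `NearExtremalTransiencePerFlow` (stmt-NavierStokesRegularity-26567),
# LINE g7-δ «coherent member selection»: STUB T2 `stub_zoomPackage` PROVED (by name, over the texts of record)

`--supports stmt-NavierStokesRegularity-26567` (helper: δ's stubs are not the registered skeleton of record; the line is PASSed,
idea-crit-4 2026-08-28, and director-activatable). Author: prover seat `ns-net-p2` (g0).

`stub_zoomPackage : ZoomPackage` (vocabulary `…Theorems.NearExtremalTransiencePerFlow.MemberSelection.{EfficientTimesData,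
NearExtremalFamily, ZoomCompact, ZoomPackage}` = the line's §0/§1 verbatim, `IsViolator` = the landed text of record): for a violator
flow with efficient-times data, along the subsequence `σ n = n + max n₀ n₁` of late indices the NS-compatible zoomed slices
`y ↦ (Mb n)⁻¹ • u (t n) ((ν / Mb n) • y)` form a near-extremal height-1 family and are zoom-compact.  Assembly of the three landed parts:
`zoomCompact_sliceFamily` (KNSS Lemma 6.1 via `zoomCompactnessKNSS`; part 1), `zoomSlices_iteratedFDeriv_le` (uniform `Cᵏ` bounds,
KNSS Prop. 4.1 on the zoom windows; part 2), the zoom-invariance identities (part 3), plus: the Type-I PINNING of the height bound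
`(T − t n)(Mb n)² ≤ 4C²ν` once `ε n < κ⋆/2` and `t n` is in the Type-I zone (universality of `κ⋆` at the Type-I height,
`flowwise_of_universal sharpDepletion_is_universal`), which turns the Taylor bound `Z ≤ Θν(T−t)P` into `Z ≤ (4C²·max Θ 0)·P` for the
zoomed slices, and the slab budgets of the slices (`stub_taoCover`).  In the line's file, `theorem stub_zoomPackage : ZoomPackage :=`
this theorem (definitional unfolding).  HONEST FRAMING: glue on landed compactness/regularity facts about hypothetical Type-I singular
flows; T1 (`CoherentSelection`) and T3 (`NoTubeSlice`, the open heart) are untouched; nothing about Navier–Stokes regularity or blow-up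
is proved; no summit is proved by a line. [cite: KochNadirashviliSereginSverak2009, Prop. 4.1 and Lemma 6.1 (arXiv:0709.3599 pp. 8, 11)]
-/

noncomputable section

open scoped Topology InnerProductSpace RealInnerProductSpace ENNReal ContDiff
open MeasureTheory Filter Set Metric
open Literature.Analysis.FluidPDE
open Summit.NavierStokesRegularity.NavierStokesRegularity.Theorems.DepletionLadder.KStar.HalfSpace
open Summit.NavierStokesRegularity.NavierStokesRegularity.Theorems.NearExtremalTransiencePerFlow.ZoneTransversality

namespace Summit.NavierStokesRegularity.NavierStokesRegularity.Theorems.NearExtremalTransiencePerFlow.MemberSelection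

-- the problem directory repeats the summit name (`NavierStokesRegularity/NavierStokesRegularity`)
set_option linter.dupNamespace false

open Summit.NavierStokesRegularity.NavierStokesRegularity.Theorems.ExtremiserTransience
open Summit.NavierStokesRegularity.NavierStokesRegularity.Theorems.RungReynoldsOne

/-- **T2 `ZoomPackage` (stub `stub_zoomPackage` of LINE δ «coherent member selection»), PROVED.**  For a violator flow with
efficient-times data, along the subsequence of late indices the NS-compatible zoomed slices
`y ↦ (Mb n)⁻¹ • u (t n) ((ν / Mb n) • y)` form a near-extremal height-1 family (zoom invariance of the efficiency, Taylor bound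
`Θ' = 4C²·max Θ 0` by the Type-I pinning `Mb n ≤ 2C√ν/√(T − t n)` once `ε n ≤ κ⋆/2`, uniform `Cᵏ` bounds from KNSS Prop. 4.1 on the
zoom windows, budgets from the Tao slab bounds) and are zoom-compact (KNSS Lemma 6.1 through `zoomCompact_sliceFamily`).
[cite: KochNadirashviliSereginSverak2009, Prop. 4.1 and Lemma 6.1 (arXiv:0709.3599 pp. 8, 11)] -/
theorem stub_zoomPackage : ZoomPackage := by
  intro C ν T u p hV Θ t Mb ε hD
  obtain ⟨hC, hν, hT, hsol, hLH, hdec, hrate, hext, -⟩ := hV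
  obtain ⟨ht, htT, hε, hMbpos, hMb, hpos, heff, htaylor⟩ := hD
  have hsν : 0 < Real.sqrt ν := Real.sqrt_pos.2 hν
  have hTt : ∀ n, 0 < T - t n := fun n => sub_pos.2 (ht n).2
  -- uniform `Cᵏ` bounds past `n₀`
  obtain ⟨n₀, hreg⟩ := zoomSlices_iteratedFDeriv_le hν hT hsol hLH hdec hrate hext ht htT hMb
  choose Λ hΛ0 hΛ using hreg
  -- the eventual Type-I rate on `(t⋆, T)`
  obtain ⟨tstar, htstar, hsub⟩ := mem_nhdsLT_iff_exists_Ioo_subset.1 hrate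
  have htstarT : tstar < T := htstar
  -- late indices: `t n > t⋆` and `ε n < κ⋆/2`
  have hk : 0 < kStar := kStar_pos
  obtain ⟨n₁, hn₁⟩ : ∃ n₁ : ℕ, ∀ n, n₁ ≤ n → tstar < t n ∧ ε n < kStar / 2 := by
    have h1 : ∀ᶠ n in atTop, t n ∈ Set.Ioi tstar := htT (Ioi_mem_nhds htstarT)
    have h2 : ∀ᶠ n in atTop, ε n ∈ Set.Iio (kStar / 2) := hε (Iio_mem_nhds (by positivity))
    obtain ⟨n₁, hn₁⟩ := eventually_atTop.1 (h1.and h2)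
    exact ⟨n₁, fun n hn => hn₁ n hn⟩
  set m : ℕ := max n₀ n₁ with hmdef
  set σ : ℕ → ℕ := fun n => n + m with hσdef
  have hσ : StrictMono σ := fun a b hab => Nat.add_lt_add_right hab m
  have hσ₀ : ∀ n, n₀ ≤ σ n := fun n => (le_max_left _ _).trans (Nat.le_add_left m n)
  have hσ₁ : ∀ n, n₁ ≤ σ n := fun n => (le_max_right _ _).trans (Nat.le_add_left m n)
  have hσT : Tendsto σ atTop atTop := hσ.tendsto_atTop
  -- Type-I pinning of the height bound: `(T − t n)·(Mb n)² ≤ 4C²ν` for `n ≥ n₁`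
  have huniv := DepletionLadder.flowwise_of_universal DepletionLadder.sharpDepletion_is_universal hν hT hsol hLH hdec
  have hC0 : 0 ≤ C := hC.le
  have hpin : ∀ n, n₁ ≤ n → (T - t n) * Mb n ^ 2 ≤ 4 * C ^ 2 * ν := by
    intro n hn
    obtain ⟨htn, hεn⟩ := hn₁ n hn
    have hsq : 0 < Real.sqrt (T - t n) := Real.sqrt_pos.2 (hTt n)
    -- height bound `N = C√ν/√(T − t n)` at time `t n`
    have hN : ∀ x, ‖u (t n) x‖ ≤ C * Real.sqrt ν / Real.sqrt (T - t n) := fun x => by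
      rw [le_div_iff₀ hsq, mul_comm]; exact hsub ⟨htn, (ht n).2⟩ x
    have hJ := huniv (t n) (ht n) _ hN
    have h1 : (kStar - ε n) * Mb n ≤ kStar * (C * Real.sqrt ν / Real.sqrt (T - t n)) := by
      have h := (heff n).trans hJ
      set D : ℝ := Real.sqrt (∫ x, ‖curl (u (t n)) x‖ ^ 2) *
        Real.sqrt (∫ x, frobeniusNormSq (fderiv ℝ (curl (u (t n))) x)) with hDdef
      have h' : (kStar - ε n) * Mb n * D ≤ kStar * (C * Real.sqrt ν / Real.sqrt (T - t n)) * D := by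
        calc (kStar - ε n) * Mb n * D
            = (kStar - ε n) * Mb n * Real.sqrt (∫ x, ‖curl (u (t n)) x‖ ^ 2) *
                Real.sqrt (∫ x, frobeniusNormSq (fderiv ℝ (curl (u (t n))) x)) := by rw [hDdef]; ring
          _ ≤ kStar * (C * Real.sqrt ν / Real.sqrt (T - t n)) * Real.sqrt (∫ x, ‖curl (u (t n)) x‖ ^ 2) *
                Real.sqrt (∫ x, frobeniusNormSq (fderiv ℝ (curl (u (t n))) x)) := h
          _ = kStar * (C * Real.sqrt ν / Real.sqrt (T - t n)) * D := by rw [hDdef]; ring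
      exact le_of_mul_le_mul_right h' (hpos n)
    have h2 : kStar / 2 * Mb n ≤ kStar * (C * Real.sqrt ν / Real.sqrt (T - t n)) :=
      le_trans (mul_le_mul_of_nonneg_right (by linarith) (hMbpos n).le) h1
    have h3 : Mb n ≤ 2 * C * Real.sqrt ν / Real.sqrt (T - t n) := by
      rw [le_div_iff₀ hsq]
      have := mul_le_mul_of_nonneg_right h2 hsq.le
      have e : kStar * (C * Real.sqrt ν / Real.sqrt (T - t n)) * Real.sqrt (T - t n) = kStar * C * Real.sqrt ν := by
        field_simp
      nlinarith [e ▸ this]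
    have h4 : Mb n * Real.sqrt (T - t n) ≤ 2 * C * Real.sqrt ν := by rwa [le_div_iff₀ hsq] at h3
    have h5 := pow_le_pow_left₀ (mul_nonneg (hMbpos n).le hsq.le) h4 2
    rw [mul_pow, mul_pow, mul_pow, Real.sq_sqrt (hTt n).le, Real.sq_sqrt hν.le] at h5
    linarith
  -- slab budgets of the slices
  have hbudget : ∀ n (k : ℕ), k = 1 ∨ k = 2 → ∫⁻ x, ‖iteratedFDeriv ℝ k (u (t n)) x‖ₑ ^ 2 < ⊤ := by
    intro n k _
    have ht' : (t n + T) / 2 ∈ Ioo 0 T := ⟨by linarith [(ht n).1], by linarith [(ht n).2]⟩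
    obtain ⟨q, -, hut, -, -⟩ := stub_taoCover hν hT hsol hLH hdec ht'
    obtain ⟨Ck, hCk⟩ := hut k
    exact (hCk (t n) ⟨(ht n).1, by linarith [(ht n).2]⟩).trans_lt ENNReal.coe_lt_top
  refine ⟨σ, Λ, max Θ 0 * (4 * C ^ 2), fun n => ε (σ n), hσ, ?_, ?_⟩
  · -- the near-extremal family
    have hv : ∀ n, ContDiff ℝ ∞ (u (t n)) := fun n => hsol.contDiff_velocity (ht n)
    refine ⟨fun n => contDiff_zoom (hv (σ n)) _ _, fun n => isDivFree_zoom (hv (σ n)) (hsol.divFree _ (ht (σ n))) _ _,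
      fun n x => ?_, fun k n x => hΛ k (σ n) (hσ₀ n) x, fun n => ⟨?_, ?_⟩, hε.comp hσT, fun n => ?_, fun n => ?_, fun n => ?_⟩
    · calc ‖(Mb (σ n))⁻¹ • u (t (σ n)) ((ν / Mb (σ n)) • x)‖ ≤ (Mb (σ n))⁻¹ * Mb (σ n) :=
            norm_zoom_le (inv_nonneg.2 (hMbpos _).le) (hMb (σ n)) x
        _ = 1 := inv_mul_cancel₀ (hMbpos _).ne'
    · exact lintegral_iteratedFDeriv_zoom_lt_top (hv (σ n)) _ (div_pos hν (hMbpos _)) 1 (hbudget (σ n) 1 (Or.inl rfl))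
    · exact lintegral_iteratedFDeriv_zoom_lt_top (hv (σ n)) _ (div_pos hν (hMbpos _)) 2 (hbudget (σ n) 2 (Or.inr rfl))
    · exact sqrt_mul_sqrt_zoom_pos (u (t (σ n))) (inv_pos.2 (hMbpos _)) (div_pos hν (hMbpos _)) (hpos (σ n))
    · have h := efficiency_zoom (u (t (σ n))) (inv_nonneg.2 (hMbpos (σ n)).le) (div_pos hν (hMbpos (σ n))) (heff (σ n))
      rwa [inv_mul_cancel₀ (hMbpos _).ne', mul_one] at h
    · have hb : 0 < ν / Mb (σ n) := div_pos hν (hMbpos _)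
      have h := taylor_zoom (u (t (σ n))) (Mb (σ n))⁻¹ hb (htaylor (σ n))
      refine h.trans (mul_le_mul_of_nonneg_right ?_ (integral_nonneg fun x => frobeniusNormSq_nonneg _))
      -- `Θ ν (T − t) / (ν/Mb)² = Θ · (T − t) Mb²/ν ≤ max Θ 0 · 4C²`
      have hq : 0 ≤ (T - t (σ n)) * Mb (σ n) ^ 2 / ν := by have := hTt (σ n); positivity
      have hq4 : (T - t (σ n)) * Mb (σ n) ^ 2 / ν ≤ 4 * C ^ 2 := by
        rw [div_le_iff₀ hν]; exact hpin (σ n) (hσ₁ n)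
      have e : Θ * (ν * (T - t (σ n))) / (ν / Mb (σ n)) ^ 2 = Θ * ((T - t (σ n)) * Mb (σ n) ^ 2 / ν) := by
        have := (hMbpos (σ n)).ne'
        field_simp
      rw [e]
      calc Θ * ((T - t (σ n)) * Mb (σ n) ^ 2 / ν) ≤ max Θ 0 * ((T - t (σ n)) * Mb (σ n) ^ 2 / ν) :=
            mul_le_mul_of_nonneg_right (le_max_left _ _) hq
        _ ≤ max Θ 0 * (4 * C ^ 2) := mul_le_mul_of_nonneg_left hq4 (le_max_right _ _)
  · -- zoom compactness along `σ`
    exact zoomCompact_sliceFamily hν hT hsol hLH hdec hrate hext (t := t ∘ σ) (Mb := Mb ∘ σ) (fun n => ht (σ n))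
      (htT.comp hσT) (fun n x => hMb (σ n) x)

end Summit.NavierStokesRegularity.NavierStokesRegularity.Theorems.NearExtremalTransiencePerFlow.MemberSelection

end
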